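import Summits.BirchSwinnertonDyer.Rank1Residual.X11b.FittingCongruenceLimit
import HarnessLib

/-!
# X11b, route R1 — the erratum's proof of its Thm. 1.1 from its Thm. 2.3 ("the argument in
# [Ski16, p. 192] applies verbatim") as a KERNEL THEOREM of commutative algebra

HONEST FRAMING (cell `b2b-bsdres`, run/shared/lean/b2b/bsd-rank1-residual/, verbatim in every
file): the goal of the cell is to DELETE the COMBINATION-SHAPED residual classes of the
Birch–Swinnerton-Dyer formula for ALL analytic-rank `≤ 1` elliptic curves over `ℚ` — "full BSD
formula for every rank `≤ 1` curve in class `C`" assembled STRICTLY from published theorems — so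
that the rank-`≤ 1` remainder becomes exactly the CONSTRUCTION-SHAPED classes, which are TYPED
(missing-input `Prop`s), NOT attempted. This is not "finishing BSD". Sub-cell
`b2b-bsdres-multr1-p1` (X11b via the re-proof of Castella 2018 Thm. A along the author's erratum):
a RESEARCH ROUTE; no claim beyond the stated class; X11b stays CONSTRUCTION-SHAPED; nothing here
changes a label. THEOREMS ONLY (no definition, no named fact, no `sorry`).

## What this file kernel-checks, and where it sits in route R1

Route R1 (`CastellaErratum*.lean`) re-assembles the erratum's Thm. A′ in the kernel: after
generations 1–2 and `multr1-p2`'s `CastellaErratumManin.lean`, `RouteGoal` (BSD(E,p) for every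
rank-one pair on `ChainLocus`) follows from TEN published named facts and ONE open input (A) = the
display [Cas18, (5.3)] ⇐ erratum Thm. 1.1 (the anticyclotomic main conjecture at `p ‖ N`) ⇐
erratum Thm. 2.3 ⇐ Fouquet–Wan 2021 Thm. 4.41 (PREPRINT). The erratum's OWN new reasoning is the
proof of Thm. 1.1 from Thm. 2.3 (erratum p. 4), replacing the withdrawn step (Cas18 Thm. 4.2's
weight-two point `φ ∈ 𝒳_𝕀^a`) by a `p`-ADIC APPROXIMATION of the `p`-new form `f = f_E` by
`p`-ordinary newforms `g_m` of weights `k_m ≡ 2 (mod p−1)`, `k_m > 2`, of level `M = N/p`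
(to which Thm. 2.3 applies), and a passage to the limit in FITTING IDEALS:

  erratum p. 4, verbatim: "for each `m ≥ 1` there exists (a) a `p`-ordinary newform
  `g_m ∈ S_{k_m}(Γ₀(M))` … (b) a `G_ℚ`-stable lattice `T_{g_m} ⊂ V_{g_m}` and an isomorphism
  `T_{g_m}/p^m T_{g_m} ≃ T/p^m T` as `𝒪[G_ℚ]`-modules; (c) an equality
  `(L^Σ_p(g_m), p^m) = (L^Σ_p(f), p^m) ⊂ Λ_𝒪^{ur}`. … By Theorem 2.3, the module `X^Σ_ac(A_{g_m})`
  is `Λ_𝒪`-torsion, with `Ch_{Λ_𝒪}(X^Σ_ac(A_{g_m}))Λ_𝒪^{ur} = (L^Σ_p(g_m))`. Moreover, by Lemma 2.2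
  we know that `Ch_{Λ_𝒪}(X^Σ_ac(A_{g_m})) = Fitt_{Λ_𝒪}(X^Σ_ac(A_{g_m}))`, and so from (b),
  Lemma 2.1, and basic properties of Fitting ideals we deduce the equality
  `(Fitt_{Λ_𝒪}(X^Σ_ac(E[p^∞])), p^m)Λ_𝒪^{ur} = (L^Σ_p(f), p^m)`. From this, the argument in
  [Ski16, p. 192] applies verbatim, using the nonvanishing of `L_p(f)` …".

  [Ski16, § 3.1, p. 192] (C. Skinner, Pacific J. Math. 283 (2016); arXiv:1407.1093 p. 13),
  verbatim up to the bracket: "From (b) together with Lemma [§ 2.3: `Sel^Σ(f)[p^m]` depends only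
  on `(T_f/p^m, T_f^+/p^m)`] we conclude that there is a `Λ_𝒪`-isomorphism … upon taking Pontryagin
  duals … `X^Σ(f)/p^m X^Σ(f) ≅ X^Σ(f_m)/p^m X^Σ(f_m)`.
  From basic properties of Fitting ideals we then conclude that there as an equality of
  `Λ_𝒪`-ideals `(F^Σ(f), p^m) = (F^Σ(f_m), p^m)`. Together with (c), (e), and (f) we then have
  `(F^Σ(f), p^m) = (𝓛^Σ_f, p^m) ⊆ Λ_𝒪`. As `𝓛_f` … is non-zero … `F^Σ(f) ≠ 0` … must be a torsion
  `Λ_𝒪`-module … `Ch^Σ(f) = F^Σ(f)` … for all integers `m`, `(Ch^Σ(f), p^m) = (𝓛^Σ_f, p^m)` …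
  [a `p`-adic convergence argument] … `(𝓛^Σ_f) = (𝒞^Σ_f) = Ch^Σ`."

THIS FILE, with its generic half `FittingCongruenceLimit.lean` (items marked ⋆ live there),
proves the algebraic content of that passage as theorems about an ARBITRARY Noetherian ring `R`, an ideal `I` inside the Jacobson radical (`I = (p)` or `(ϖ)`), a finite `R`-module `M`
(`= X^Σ_ac(E[p^∞])`, resp. `X^Σ(f)`), finite `R`-modules `N m` (`= X^Σ_ac(A_{g_m})`, resp.
`X^Σ(f_m)`), elements `L` (`= L^Σ_p(f)`) and `Lm m` (`= L^Σ_p(g_m)`):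

* ⋆`fittingIdeal_sup_eq_of_quotEquiv` — "basic properties of Fitting ideals": an `R`-linear
  isomorphism `M/IM ≅ N/IN` gives `Fitt_k(M) + I = Fitt_k(N) + I` (Fitting ideals commute with the
  base change `R → R/I`, tree theorem `Module.fittingIdeal_baseChange`, Stacks 07ZA (3)).
* ⋆`iInf_sup_pow_eq_self` — Krull's intersection theorem in the form `⋂_m (J + I^m) = J` for every
  ideal `J` when `I ⊆ Jac(R)` (Mathlib's `Ideal.iInf_pow_smul_eq_bot_of_le_jacobson` on `R/J`).
* ⋆`fittingIdeal_sup_pow_eq_of_congruences` — the displayed "(Fitt-L-eq)":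
  `Fitt₀(M) + I^m = (L) + I^m` for every `m`, from (b)∘Lemma 2.1 [the quotient isomorphisms],
  Thm. 2.3∘Lemma 2.2 [`Fitt₀(N m) = (Lm m)`] and (c) [`(Lm m) + I^m = (L) + I^m`].
* ⋆`fittingIdeal_eq_span_of_congruences` — hence `Fitt₀(M) = (L)` (by Krull; this REPLACES the
  `p`-adic convergence argument of [Ski16, p. 192] and does not use "`Ch = Fitt`" for `M` itself).
* ⋆`lengthAt_eq_of_fittingIdeal_zero_eq`, ⋆`charIdeal_eq_of_fittingIdeal_zero_eq`,
  ⋆`charIdeal_quotient_span_singleton`, ⋆`charIdeal_eq_span_of_fittingIdeal_zero_eq_span` — over a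
  Noetherian UFD (`Λ_𝒪 = 𝒪⟦T⟧`, `ℤ_p⟦T⟧`): a finite module with PRINCIPAL order ideal
  `Fitt₀(M) = (L)`, `L ≠ 0`, is torsion with characteristic ideal `char(M) = (L)` (localise at a
  height-one prime `𝔭 = (π)`: `R_𝔭` is a DVR, Fitting ideals localise, and over a DVR
  `length(R_𝔭/Fitt₀) = length` — tree theorems `Module.fittingIdeal_of_isLocalizedModule`,
  `Module.length_quotient_fittingIdeal_zero`; then `∏_{ht 𝔭=1} 𝔭^{v_𝔭(L)} = (L)`,
  `finprod_heightOne_pow_eq_span_prod`).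
* `isTorsion_and_charIdeal_eq_of_congruences` — THE SKELETON of erratum p. 4 / [Ski16, p. 192]:
  inputs (b)∘Lemma 2.1, Thm. 2.3∘Lemma 2.2, (c), `L ≠ 0` (Cornut–Vatsal + the reciprocity law of
  [Cas20, Thm. 5.3]) ⟹ `M` is torsion and `char(M) = Fitt₀(M) = (L)` — the conclusion of Thm. 1.1
  for `Σ`. `iwasawaAlgebra_isTorsion_and_charIdeal_eq_of_congruences` is the same over the tree's
  `Λ = ℤ_p⟦T⟧` with `I = (p)` (Skinner's setting with `𝒪 = ℤ_p`).
* `charIdeal_eq_span_of_imprimitive` — the `Σ`-removal bookkeeping ("it suffices to prove the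
  result for `X^Σ` and `L^Σ`", [JSW17, Thm. 6.1.6]): cancel the common Euler factor.

WHAT IS NOT HERE (and stays exactly as recorded in `CastellaErratum.lean` /
`CastellaErratumLinks.lean`): the objects `X^Σ_ac`, `L^Σ_p` themselves (no anticyclotomic
`Λ`-adic Selmer group / BDP `p`-adic `L`-function in the tree — the typed missing CONSTRUCTION of
the X11b row), Hida theory (a), the Galois-cohomological Lemmas 2.1/2.2 and [Cas20, Thm. 2.11]
behind (b), (c), and Thm. 2.3 itself (⇐ [FW21, Thm. 4.41], PREPRINT — the one unrefereed atom).
So the OPEN input (A) of route R1 now factors as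
  (A) ⇐ [display ⇐ IMC(f): Cas18 Thms. 2.3/3.2, PUB, shadow-typed]
      ∘ [IMC(f) ⇐ {Thm. 2.3 for the g_m} + (a),(b),(c) + Lemmas 2.1/2.2 + L_p(f) ≠ 0: THIS FILE, kernel]
      ∘ [Thm. 2.3 ⇐ … ⇐ FW21 Thm. 4.41: OPEN].
Ring bookkeeping (honest): the erratum's identity lives in `Λ_𝒪^{ur} = Λ_{R₀} ⊗̂ 𝒪` with `Ch`
taken over `Λ_𝒪`; the theorems below are stated over ONE ring (`R = Λ_𝒪^{ur}` for the Fitting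
statements — Fitting ideals commute with the faithfully flat base change `Λ_𝒪 → Λ_𝒪^{ur}`,
`Module.fittingIdeal_baseChange` —, `R` a Noetherian UFD such as `Λ_𝒪` or `R₀⟦T⟧` for the
characteristic-ideal statements); this is exactly [Ski16, § 3.1]'s setting (everything in `Λ_𝒪`).

References: F. Castella, *Erratum to "On the p-part of the Birch–Swinnerton-Dyer formula for
multiplicative primes"* (web, n.d.; = arXiv:2409.01360 Thm. 3.1), p. 4 [Castella2018Erratum];
C. Skinner, *Multiplicative reduction and the cyclotomic main conjecture for GL₂*, Pacific J. Math.
283 (2016) 171–200, § 2.3 and § 3.1 (p. 192) [Skinner2016PacificMC]; The Stacks Project,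
Tag 07ZA [StacksProject]; D. Eisenbud, GTM 150, Cor. 20.5 [Eisenbud1995]; L. Washington, GTM 83,
§13.2 [Washington1997].
-/

noncomputable section

open scoped TensorProduct

open Literature.RingTheory.FittingIdeal Literature.NumberTheory.EllipticCurves
  Literature.NumberTheory.EllipticCurves.Module

namespace Summit.BirchSwinnertonDyer.Rank1Residual.X11b.CongruenceLimit

universe u

variable {R : Type u} [CommRing R]

/-! ### The skeleton of erratum p. 4 / [Ski16, p. 192] -/

section Skeleton

variable [IsNoetherianRing R] [IsDomain R] [UniqueFactorizationMonoid R]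
  {M : Type*} [AddCommGroup M] [Module R M] [Module.Finite R M]
  (N : ℕ → Type*) [∀ m, AddCommGroup (N m)] [∀ m, Module R (N m)] [∀ m, Module.Finite R (N m)]

/-- **Erratum, proof of Thm. 1.1 from Thm. 2.3 (p. 4) — "the argument in [Ski16, p. 192] applies
verbatim" — as a kernel theorem.** Let `R` be a Noetherian UFD (`Λ_𝒪 = 𝒪⟦T⟧`; `ℤ_p⟦T⟧`), `I`
an ideal inside the Jacobson radical (`(p)` or `(ϖ)`), `M` a finite `R`-module
(`X^Σ_ac(E[p^∞])`, resp. [Ski16] `X^Σ(f)`) and `L ∈ R` nonzero (`L^Σ_p(f)`; nonvanishing by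
Cornut–Vatsal and [Cas20, Thm. 5.3], resp. Rohrlich). Suppose that for every `m ≥ 1` there are a
finite `R`-module `N_m` (`X^Σ_ac(A_{g_m})`) and `L_m ∈ R` (`L^Σ_p(g_m)`) with
`e`: `M/I^mM ≅ N_m/I^mN_m` — (b) `T_{g_m}/p^m ≃ T/p^m` and Lemma 2.1, dualised —,
`hF`: `Fitt₀(N_m) = (L_m)` — Thm. 2.3 for `g_m` with Lemma 2.2 (`Ch = Fitt`) —, and
`hc`: `(L_m) + I^m = (L) + I^m` — (c), [Cas20, Thm. 2.11]. THEN `M` is `R`-torsion,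
`Fitt₀(M) = (L)` and `char(M) = (L)`: the conclusion of Thm. 1.1 for `Σ`
("`X^Σ_ac(E[p^∞])` is `Λ`-torsion and `Ch_Λ(X^Σ_ac(E[p^∞])) = (L^Σ_p(f))`"). The inputs (a)–(c),
Lemmas 2.1/2.2 and Thm. 2.3 are NOT proved here (no `Λ`-adic Selmer groups in the tree); Thm. 2.3
rests on [FW21, Thm. 4.41] (PREPRINT). Pure algebra; CONDITIONAL on nothing; deletes nothing; X11b
stays CONSTRUCTION-SHAPED. [cite: Castella2018Erratum, proof of Thm. 1.1 (p. 4)]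
[cite: Skinner2016PacificMC, §3.1 (p. 192)] -/
theorem isTorsion_and_charIdeal_eq_of_congruences (I : Ideal R) (hI : I ≤ (⊥ : Ideal R).jacobson)
    {L : R} (hL : L ≠ 0) (Lm : ℕ → R)
    (e : ∀ m : ℕ, 1 ≤ m →
      ((M ⧸ (I ^ m • (⊤ : Submodule R M))) ≃ₗ[R] (N m ⧸ (I ^ m • (⊤ : Submodule R (N m))))))
    (hF : ∀ m : ℕ, 1 ≤ m → Module.fittingIdeal R (N m) 0 = Ideal.span {Lm m})
    (hc : ∀ m : ℕ, 1 ≤ m → Ideal.span {Lm m} ⊔ I ^ m = Ideal.span {L} ⊔ I ^ m) :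
    Module.IsTorsion R M ∧ Module.fittingIdeal R M 0 = Ideal.span {L} ∧
      charIdeal R M = Ideal.span {L} := by
  have hFitt : Module.fittingIdeal R M 0 = Ideal.span {L} :=
    fittingIdeal_eq_span_of_congruences I L N Lm hI e hF hc
  exact ⟨isTorsion_of_fittingIdeal_zero_eq_span hFitt hL, hFitt,
    charIdeal_eq_span_of_fittingIdeal_zero_eq_span hFitt hL⟩

end Skeleton

/-! ### `Σ`-removal ("it suffices to prove the result for `X^Σ` and `L^Σ`") -/

/-- **`Σ`-removal bookkeeping** (erratum p. 4: "As in the proof of Theorem 2.3, it suffices to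
prove the result for `X^Σ_ac(E[p^∞])` and `L^Σ_p(f)`"; [JSW17, Thm. 6.1.6]; [Ski16, § 2.3]:
`Ch^Σ = Ch · ∏_{ℓ ∈ Σ, ℓ ≠ p} P_ℓ`): if `char(X^Σ) = char(X)·(P)` and `L^Σ ~ L·P` with the same
nonzero Euler factor `P`, then `char(X^Σ) = (L^Σ)` gives `char(X) = (L)` — cancellation of a
nonzero principal ideal in a domain. The two factorisations are inputs (exact sequence of Selmer
groups; interpolation property), not proved here.
[cite: Skinner2016PacificMC, §2.3 and §3.1] -/
theorem charIdeal_eq_span_of_imprimitive [IsDomain R] {X XS : Type*} [AddCommGroup X]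
    [Module R X] [AddCommGroup XS] [Module R XS] {L LS P : R} (hP : P ≠ 0)
    (hX : charIdeal R XS = charIdeal R X * Ideal.span {P}) (hL : Associated LS (L * P))
    (h : charIdeal R XS = Ideal.span {LS}) : charIdeal R X = Ideal.span {L} := by
  rw [hX, Ideal.span_singleton_eq_span_singleton.mpr hL, ← Ideal.span_singleton_mul_span_singleton,
    mul_comm (charIdeal R X), mul_comm (Ideal.span {L})] at h
  exact (Ideal.span_singleton_mul_right_inj hP).mp h

/-! ### Skinner's setting: the tree's Iwasawa algebra `Λ = ℤ_p⟦T⟧`, `I = (p)` -/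

section Iwasawa

variable (p : ℕ) [Fact p.Prime]

/-- `(p) ⊆ Jac(Λ)`: `Λ = ℤ_p⟦T⟧` is local and `p` is not a unit. [folklore] -/
theorem span_C_p_le_jacobson :
    Ideal.span {(PowerSeries.C (p : ℤ_[p]) : IwasawaAlgebra p)} ≤
      (⊥ : Ideal (IwasawaAlgebra p)).jacobson := by
  rw [IsLocalRing.jacobson_eq_maximalIdeal ⊥ bot_ne_top, Ideal.span_le, Set.singleton_subset_iff]
  exact (IwasawaAlgebra.prime_C p).not_unit

/-- **[Ski16, § 3.1 (p. 192)] in the tree's `Λ = ℤ_p⟦T⟧` (`𝒪 = ℤ_p`), kernel form.** For a finite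
`Λ`-module `M` (`X^Σ(f)`), `L ∈ Λ` nonzero (`𝓛^Σ_f`, Rohrlich), and for each `m ≥ 1` a finite
`Λ`-module `N_m` (`X^Σ(f_m)`) and `L_m` (`𝓛^Σ_{f_m}`) with `M/p^m ≅ N_m/p^m` ((b) + [Ski16, § 2.3], `Sel^Σ(f)[p^m] ≅ Sel^Σ(f_m)[p^m]`),
`Fitt_Λ(N_m) = (L_m)` ((e)+(f): the main conjecture for `f_m` and `F^Σ(f_m) = Ch^Σ(f_m)`) and
`(L_m, p^m) = (L, p^m)` ((c)): `M` is `Λ`-torsion and `Ch_Λ(M) = F_Λ(M) = (L)` — Theorem A of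
[Ski16] modulo its inputs; the same skeleton serves erratum Thm. 1.1 (anticyclotomic, `p ‖ N`).
[cite: Skinner2016PacificMC, §3.1 (p. 192)] [cite: Castella2018Erratum, proof of Thm. 1.1 (p. 4)] -/
theorem iwasawaAlgebra_isTorsion_and_charIdeal_eq_of_congruences
    {M : Type*} [AddCommGroup M] [Module (IwasawaAlgebra p) M] [Module.Finite (IwasawaAlgebra p) M]
    (N : ℕ → Type*) [∀ m, AddCommGroup (N m)] [∀ m, Module (IwasawaAlgebra p) (N m)]
    [∀ m, Module.Finite (IwasawaAlgebra p) (N m)]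
    {L : IwasawaAlgebra p} (hL : L ≠ 0) (Lm : ℕ → IwasawaAlgebra p)
    (e : ∀ m : ℕ, 1 ≤ m →
      ((M ⧸ ((Ideal.span {(PowerSeries.C (p : ℤ_[p]) : IwasawaAlgebra p)}) ^ m •
          (⊤ : Submodule (IwasawaAlgebra p) M))) ≃ₗ[IwasawaAlgebra p]
        (N m ⧸ ((Ideal.span {(PowerSeries.C (p : ℤ_[p]) : IwasawaAlgebra p)}) ^ m •
          (⊤ : Submodule (IwasawaAlgebra p) (N m))))))
    (hF : ∀ m : ℕ, 1 ≤ m → Module.fittingIdeal (IwasawaAlgebra p) (N m) 0 = Ideal.span {Lm m})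
    (hc : ∀ m : ℕ, 1 ≤ m →
      Ideal.span {Lm m} ⊔ (Ideal.span {(PowerSeries.C (p : ℤ_[p]) : IwasawaAlgebra p)}) ^ m =
        Ideal.span {L} ⊔ (Ideal.span {(PowerSeries.C (p : ℤ_[p]) : IwasawaAlgebra p)}) ^ m) :
    Module.IsTorsion (IwasawaAlgebra p) M ∧
      Module.fittingIdeal (IwasawaAlgebra p) M 0 = Ideal.span {L} ∧
      charIdeal (IwasawaAlgebra p) M = Ideal.span {L} :=
  isTorsion_and_charIdeal_eq_of_congruences N _ (span_C_p_le_jacobson p) hL Lm e hF hc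

end Iwasawa

end Summit.BirchSwinnertonDyer.Rank1Residual.X11b.CongruenceLimit

end
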